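import Literature.Barriers.ValiantsHypothesis.CT23ProjCircuitSubstitution
import HarnessLib

/-!
# Squaring an explicitly encoded matrix with ONE copy of its encoder
# (Chatterjee–Tengse arXiv:2309.07612v2, Prop. 2.28 / Claim 38, the step `A ↦ A²`;
# val-lit t18 g7, X-CT23 engine brick E-c)

Theorem-only (plus plumbing `def`s) companion of
`CT23LowerBoundsFromSuccinctHittingSets.lean` and `CT23ProjCircuitSubstitution.lean`; NO named
facts. Honest framing: one step of the source's "determinant of an explicit matrix in `VPSPACE`"
engine (v1 Prop. 36 / Claim 38, held text `paper:arxiv-2309.07612` p0013.txt:L9–L25); it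
discharges nothing by itself; `VP ≠ VNP` is NOT proved and nothing here bears on it.

## The printed step (Claim 38)

"`P₁(x,u,w,v,z) := C_A(x, ((1−z)u + zw), ((1−z)w + zv))`,
`D₁(x,u,v) := Σ_{w_1} Σ_{w_2} ⋯ Σ_{w_L} ( proj_{z=0} P₁(x,u,w,v,z) · proj_{z=1} P₁(x,u,w,v,z) )`.
Note that `D₁` encodes the adjacency matrix `A²` when `C_A` encodes `A` and `L = O(log N)` is the
length of the vertex labels of `A`. … As each of the `P_{i+1}`s and `D_{i+1}`s have circuits (with
projection gates) of size `O(log N)` with exactly one use of `D_i` and `P_{i+1}` respectively,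
all these increases are additive."

## Rendering

One variable type `τ`; an ENCODER is a polynomial `E ∈ k[τ]` with two blocks of index variables
`a b : Fin L → τ` (Def. 2.27 / v1 Def. 34: "`C(x, i, j) = M[i, j]` for `i, j` binary"); its matrix
`matOf a b E` is indexed by bit-vectors `Fin L → Bool` (entry = substitute the bits for the
blocks). The step uses a fresh block `w : Fin L → τ` and a fresh selector variable `z : τ`
(injective and pairwise disjoint: one injective map `(Fin L ⊕ Fin L) ⊕ (Fin L ⊕ Unit) → τ`), not
occurring in `E`. Then `sqPoly` = the printed `D₁` and **`matOf a b (sqPoly …) = (matOf a b E)²`**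
(`matOf_sqPoly`). Circuit side (`sqCircuit`, via `ProjCircuit.subst` of brick E-a): from a
constant-free fan-in-two projection circuit for `E` that does not PROJECT the blocks / `z`, a
constant-free fan-in-two projection circuit for `sqPoly` of size exactly `|C| + 11·L + 3`
(`8` prefix gates per index bit for the two multiplexers, one production gate block `+3`, one
summation block `+3` per bit of `w`; `size_sqCircuit`) — "exactly one use of" the encoder; it
projects only `z` and the block `w` on top of what `C` projects (`projVars_sqCircuit_subset`), so
the step can be ITERATED with fresh `(w', z')` (the source's `D_i ↦ D_{i+1}`; not done here).

## Main declarations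

* `onBlock`, `bit`, `blkBits`, `blkBoolSum`, `summation_blkBoolSum`, `blkBoolSum_eq_sum`,
  `ProjCircuit.blkSumCircuit` (+ `eval_/size_/isFanInTwo_/hasSignConstants_/projVars_…`):
  Boolean sums over an injective block of workspace variables (generalising the `Fin m`-indexed
  `partialBoolSum` / `boolSumCircuit` of the statement file).
* `matOf a b E` (Def. 2.27), `Fresh a b w z`, `muxA`, `muxB`, `muxSubst`, `sqPoly` (= `D₁`),
  `projVar_zero_aeval_muxSubst` / `projVar_one_aeval_muxSubst` (`proj_{z=0} P₁ = E(a,w)`,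
  `proj_{z=1} P₁ = E(w,b)`), **`matOf_sqPoly : matOf a b (sqPoly a b w z E) = matOf a b E * matOf a b E`**.
* `muxACircuit`, `muxBCircuit`, `muxList`, `muxOperands`, `sqCircuit`, `eval_muxOperands`,
  `substCompat_muxSubst`, **`eval_sqCircuit`**, **`size_sqCircuit`**, `isFanInTwo_sqCircuit`,
  `hasSignConstants_sqCircuit`, `projVars_sqCircuit_subset`.

## References

* [ChatterjeeTengse2023] P. Chatterjee, A. Tengse, *Lower Bounds from Succinct Hitting Sets*,
  arXiv:2309.07612v2, Def. 2.27, Prop. 2.28, Claim 38 (v1: Def. 34, Prop. 36; p0011.txt:L82,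
  p0012.txt:L17–L20, p0013.txt:L9–L25).
-/

noncomputable section

open MvPolynomial

namespace Literature.Barriers.ValiantsHypothesis

open Literature.Computability.AlgebraicComplexity

universe u v

variable {k : Type u} [CommRing k] {τ : Type v} [DecidableEq τ] {L : ℕ}

/-! ### Substitutions acting on a block of variables -/

section Blocks

/-- Substitute `f l` for the block variable `w l` and `g v` for every other variable `v`.
[cite: ChatterjeeTengse2023, Def. 2.27 (v1: Def. 34)] -/
def onBlock {β : Type*} (w : Fin L → τ) (f : Fin L → β) (g : τ → β) : τ → β :=
  fun v => if h : ∃ l, w l = v then f (Fin.find _ h) else g v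

/-- On the block. [cite: ChatterjeeTengse2023, Def. 2.27 (v1: Def. 34)] -/
theorem onBlock_blk {β : Type*} {w : Fin L → τ} (hw : Function.Injective w) (f : Fin L → β)
    (g : τ → β) (l : Fin L) : onBlock w f g (w l) = f l := by
  unfold onBlock
  have h : ∃ l', w l' = w l := ⟨l, rfl⟩
  rw [dif_pos h]
  congr 1
  rw [Fin.find_eq_iff]
  exact ⟨rfl, fun j hj hj' => absurd (hw hj' ▸ hj) (lt_irrefl _)⟩

/-- Off the block. [cite: ChatterjeeTengse2023, Def. 2.27 (v1: Def. 34)] -/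
theorem onBlock_of_ne {β : Type*} {w : Fin L → τ} {v : τ} (hv : ∀ l, w l ≠ v) (f : Fin L → β)
    (g : τ → β) : onBlock w f g v = g v := by
  unfold onBlock
  rw [dif_neg (fun ⟨l, hl⟩ => hv l hl)]

/-- The polynomial of a bit. [cite: ChatterjeeTengse2023, Def. 2.27 (v1: Def. 34)] -/
def bit (c : Bool) : MvPolynomial τ k := if c then 1 else 0

omit [DecidableEq τ] in
/-- Algebra maps fix bits. [cite: ChatterjeeTengse2023, Def. 2.27 (v1: Def. 34)] -/
@[simp] theorem aeval_bit (f : τ → MvPolynomial τ k) (c : Bool) :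
    aeval f (bit c : MvPolynomial τ k) = bit c := by
  unfold bit; split_ifs <;> simp

/-- Projections fix bits. [cite: ChatterjeeTengse2023, Def. 2.19 (v1: Def. 27)] -/
@[simp] theorem projVar_bit (i : τ) (c' : k) (c : Bool) :
    projVar i c' (bit c : MvPolynomial τ k) = bit c := by
  unfold bit; split_ifs <;> simp

end Blocks

/-! ### Boolean sums over a block of workspace variables (Σ_{w_1} ⋯ Σ_{w_L}) -/

section BlockSums

variable {w : Fin L → τ}

/-- Substituting bits `e` for the first `j` variables of the block `w`.
[cite: ChatterjeeTengse2023, Def. 2.23 (v1: Def. 30)] -/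
def blkBits (w : Fin L → τ) (j : ℕ) (e : Fin j → Bool) : τ → MvPolynomial τ k :=
  onBlock w (fun l => if h : (l : ℕ) < j then bit (e ⟨l, h⟩) else X (w l)) X

/-- The partial Boolean sum over the first `j` variables of the block:
`Σ_{e ∈ {0,1}^j} Q[w_l := e_l, l < j]`. [cite: ChatterjeeTengse2023, Def. 2.23 (v1: Def. 30)] -/
def blkBoolSum (w : Fin L → τ) (j : ℕ) (Q : MvPolynomial τ k) : MvPolynomial τ k :=
  ∑ e : Fin j → Bool, aeval (blkBits w j e) Q

/-- Nothing summed. [cite: ChatterjeeTengse2023, Def. 2.23 (v1: Def. 30)] -/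
theorem blkBoolSum_zero (hw : Function.Injective w) (Q : MvPolynomial τ k) :
    blkBoolSum w 0 Q = Q := by
  rw [blkBoolSum, Fintype.sum_unique]
  have : ∀ e : Fin 0 → Bool, blkBits (k := k) w 0 e = X := fun e => by
    funext v
    by_cases h : ∃ l, w l = v
    · obtain ⟨l, rfl⟩ := h
      rw [blkBits, onBlock_blk hw]; simp
    · rw [blkBits, onBlock_of_ne (fun l hl => h ⟨l, hl⟩)]
  rw [this, aeval_X_left, AlgHom.id_apply]

/-- One projection of the next block variable extends the bit substitution.
[cite: ChatterjeeTengse2023, Def. 2.23 (v1: Def. 30)] -/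
theorem projVar_blkBits (hw : Function.Injective w) {j : ℕ} (hj : j < L) (e : Fin j → Bool)
    (c : Bool) (v : τ) :
    projVar (w ⟨j, hj⟩) (if c then 1 else 0) (blkBits (k := k) w j e v) =
      blkBits w (j + 1) (Fin.snoc e c) v := by
  by_cases h : ∃ l, w l = v
  · obtain ⟨l, rfl⟩ := h
    rw [blkBits, blkBits, onBlock_blk hw, onBlock_blk hw]
    rcases lt_trichotomy (l : ℕ) j with hlt | heq | hgt
    · have h1 : (l : ℕ) < j + 1 := by omega
      have hs : Fin.snoc (α := fun _ => Bool) e c ⟨l, h1⟩ = e ⟨l, hlt⟩ := by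
        have : (⟨l, h1⟩ : Fin (j + 1)) = Fin.castSucc ⟨l, hlt⟩ := Fin.ext rfl
        rw [this, Fin.snoc_castSucc]
      rw [dif_pos hlt, dif_pos h1, hs, projVar_bit]
    · have h1 : (l : ℕ) < j + 1 := by omega
      have hl : l = ⟨j, hj⟩ := Fin.ext heq
      have hs : Fin.snoc (α := fun _ => Bool) e c ⟨l, h1⟩ = c := by
        have : (⟨l, h1⟩ : Fin (j + 1)) = Fin.last j := Fin.ext heq
        rw [this, Fin.snoc_last]
      rw [dif_neg (by omega), dif_pos h1, hs, hl, projVar_X_self]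
      cases c <;> simp [bit]
    · have hne : w l ≠ w ⟨j, hj⟩ := fun h' => by
        have := congrArg Fin.val (hw h'); simp at this; omega
      rw [dif_neg (by omega), dif_neg (by omega), projVar_X_of_ne hne]
  · have hv : ∀ l, w l ≠ v := fun l hl => h ⟨l, hl⟩
    rw [blkBits, blkBits, onBlock_of_ne hv, onBlock_of_ne hv, projVar_X_of_ne (hv _).symm]

/-- **One summation gate per block variable.** [cite: ChatterjeeTengse2023, Def. 2.23 (v1: Def. 30)] -/
theorem summation_blkBoolSum (hw : Function.Injective w) {j : ℕ} (hj : j < L)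
    (Q : MvPolynomial τ k) :
    summation (w ⟨j, hj⟩) (blkBoolSum w j Q) = blkBoolSum w (j + 1) Q := by
  have key : ∀ c : Bool, projVar (w ⟨j, hj⟩) (if c then 1 else 0) (blkBoolSum w j Q) =
      ∑ e : Fin j → Bool, aeval (blkBits w (j + 1) (Fin.snoc e c)) Q := fun c => by
    rw [blkBoolSum, projVar, map_sum]
    refine Finset.sum_congr rfl fun e _ => ?_
    change projVar (w ⟨j, hj⟩) (if c then 1 else 0) (aeval (blkBits w j e) Q) = _
    rw [projVar_aeval]
    have hfun : (fun v => projVar (w ⟨j, hj⟩) (if c then 1 else 0) (blkBits w j e v)) =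
        blkBits (k := k) w (j + 1) (Fin.snoc e c) :=
      funext fun v => projVar_blkBits hw hj e c v
    rw [hfun]
  have h0 := key false
  have h1 := key true
  simp only [Bool.false_eq_true, ↓reduceIte] at h0
  simp only [↓reduceIte] at h1
  rw [summation, h0, h1, blkBoolSum,
    ← Fintype.sum_equiv (Fin.snocEquiv fun _ => Bool) (fun p => aeval (blkBits w (j + 1)
      (Fin.snoc p.2 p.1)) Q) _ (fun p => rfl), Fintype.sum_prod_type, Fintype.sum_bool, add_comm]

/-- All `L` block variables summed: `Σ_{κ ∈ {0,1}^L} Q[w := κ]`.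
[cite: ChatterjeeTengse2023, Def. 2.23 (v1: Def. 30)] -/
theorem blkBoolSum_eq_sum (Q : MvPolynomial τ k) :
    blkBoolSum w L Q = ∑ κ : Fin L → Bool, aeval (onBlock w (fun l => bit (κ l)) X) Q := by
  rw [blkBoolSum]
  refine Finset.sum_congr rfl fun κ _ => ?_
  have hf : (fun l : Fin L => if h : (l : ℕ) < L then bit (κ ⟨l, h⟩) else X (w l)) =
      fun l => (bit (κ l) : MvPolynomial τ k) := by
    funext l
    rw [dif_pos l.is_lt]
  have : blkBits (k := k) w L κ = onBlock w (fun l => bit (κ l)) X := by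
    unfold blkBits
    rw [hf]
  rw [this]

namespace ProjCircuit

/-- `j` summation gates over the block variables `w_0, …, w_{j-1}` on top of `P`.
[cite: ChatterjeeTengse2023, Def. 2.23 and Claim 38 "`Σ_{w_1} ⋯ Σ_{w_L}`" (v1: Def. 30; p0013.txt:L13)] -/
def blkSumCircuit (P : ProjCircuit k τ) (w : Fin L → τ) : ℕ → ProjCircuit k τ
  | 0 => P
  | j + 1 => if h : j < L then (blkSumCircuit P w j).summationCircuit (w ⟨j, h⟩)
      else blkSumCircuit P w j

/-- It computes the partial Boolean sums over the block. [cite: ChatterjeeTengse2023, Def. 2.23 (v1: Def. 30)] -/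
theorem eval_blkSumCircuit (P : ProjCircuit k τ) (hw : Function.Injective w) {j : ℕ} (hj : j ≤ L) :
    (P.blkSumCircuit w j).eval = blkBoolSum w j P.eval := by
  induction j with
  | zero => rw [blkSumCircuit, blkBoolSum_zero hw]
  | succ j ih =>
    have hj' : j < L := by omega
    rw [blkSumCircuit, dif_pos hj', eval_summationCircuit, ih hj'.le, summation_blkBoolSum hw]

omit [DecidableEq τ] in
/-- Size: `+3` per block variable. [cite: ChatterjeeTengse2023, Def. 2.23 (v1: Def. 30)] -/
theorem size_blkSumCircuit (P : ProjCircuit k τ) (w : Fin L → τ) {j : ℕ} (hj : j ≤ L) :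
    (P.blkSumCircuit w j).size = P.size + 3 * j := by
  induction j with
  | zero => rfl
  | succ j ih =>
    have hj' : j < L := by omega
    rw [blkSumCircuit, dif_pos hj', size_summationCircuit, ih hj'.le]
    ring

omit [DecidableEq τ] in
/-- Fan-in two is kept. [cite: ChatterjeeTengse2023, Def. 2.23 (v1: Def. 30)] -/
theorem isFanInTwo_blkSumCircuit {P : ProjCircuit k τ} (h : P.IsFanInTwo) (w : Fin L → τ)
    (j : ℕ) : (P.blkSumCircuit w j).IsFanInTwo := by
  induction j with
  | zero => exact h
  | succ j ih =>
    rw [blkSumCircuit]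
    split_ifs
    · exact isFanInTwo_summationCircuit ih _
    · exact ih

omit [DecidableEq τ] in
/-- Constant-freeness is kept. [cite: ChatterjeeTengse2023, Def. 2.23 (v1: Def. 30)] -/
theorem hasSignConstants_blkSumCircuit {P : ProjCircuit k τ} (h : P.HasSignConstants)
    (w : Fin L → τ) (j : ℕ) : (P.blkSumCircuit w j).HasSignConstants := by
  induction j with
  | zero => exact h
  | succ j ih =>
    rw [blkSumCircuit]
    split_ifs
    · exact hasSignConstants_summationCircuit ih _
    · exact ih

omit [DecidableEq τ] in
/-- The block-sum circuit projects only the block variables on top of what `P` projects.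
[cite: ChatterjeeTengse2023, Def. 2.23 (v1: Def. 30)] -/
theorem projVars_blkSumCircuit_subset [DecidableEq τ] (P : ProjCircuit k τ) (w : Fin L → τ)
    (j : ℕ) : (P.blkSumCircuit w j).projVars ⊆ P.projVars ∪ Set.range w := by
  induction j with
  | zero => exact fun v hv => Or.inl hv
  | succ j ih =>
    rw [blkSumCircuit]
    split_ifs with h
    · rintro v ⟨b, u, hg⟩
      simp only [summationCircuit, List.mem_append, List.mem_cons, List.mem_nil_iff, or_false,
        Gate.proj.injEq] at hg
      rcases hg with hg | ⟨rfl, -, -⟩ | ⟨rfl, -, -⟩ | hg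
      · exact ih ⟨b, u, hg⟩
      · exact Or.inr ⟨_, rfl⟩
      · exact Or.inr ⟨_, rfl⟩
      · cases hg
    · exact ih

end ProjCircuit

end BlockSums

/-! ### Explicit matrices and the squaring polynomial `D₁` -/

section Squaring

omit [DecidableEq τ] in
/-- Two algebra substitutions that agree on the variables of `E` agree on `E`. [folklore] -/
private theorem aeval_congr_vars {f g : τ → MvPolynomial τ k} {E : MvPolynomial τ k}
    (h : ∀ v ∈ E.vars, f v = g v) : aeval f E = aeval g E := by
  simp only [MvPolynomial.aeval_def]
  exact MvPolynomial.eval₂Hom_congr' rfl (fun v hv _ => h v hv) rfl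

/-- **The matrix of an encoder** (Def. 2.27: "`C(x, i, j) = M[i,j]` for `i, j` the binary
representations"): rows and columns indexed by the bit-vectors of the two index blocks `a`, `b`;
entry = the encoder with the bits substituted. [cite: ChatterjeeTengse2023, Def. 2.27 (v1: Def. 34)]
locator: paper:arxiv-2309.07612 p0011.txt:L82 -/
def matOf (a b : Fin L → τ) (E : MvPolynomial τ k) :
    Matrix (Fin L → Bool) (Fin L → Bool) (MvPolynomial τ k) :=
  Matrix.of fun α β => aeval (onBlock a (fun l => bit (α l)) (onBlock b (fun l => bit (β l)) X)) E

/-- The index blocks `a, b`, the fresh workspace block `w` and the fresh selector `z` are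
distinct variables (one injective map). [cite: ChatterjeeTengse2023, Claim 38 (v1: p0013.txt:L9–L13)] -/
structure Fresh (a b w : Fin L → τ) (z : τ) : Prop where
  /-- all of `a, b, w, z` are pairwise distinct variables -/
  inj : Function.Injective (Sum.elim (Sum.elim a b) (Sum.elim w fun _ : Unit => z))

namespace Fresh

variable {a b w : Fin L → τ} {z : τ} (F : Fresh a b w z)
include F

omit [DecidableEq τ] in
/-- `a` is injective (freshness of Claim 38's `w`, `z`). [cite: ChatterjeeTengse2023, Claim 38 (v1: p0013.txt:L9–L13)] -/
theorem a_inj : Function.Injective a := fun l l' h => by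
  have := @F.inj (Sum.inl (Sum.inl l)) (Sum.inl (Sum.inl l')) (by simpa using h)
  simpa using this

omit [DecidableEq τ] in
/-- `b` is injective (freshness of Claim 38's `w`, `z`). [cite: ChatterjeeTengse2023, Claim 38 (v1: p0013.txt:L9–L13)] -/
theorem b_inj : Function.Injective b := fun l l' h => by
  have := @F.inj (Sum.inl (Sum.inr l)) (Sum.inl (Sum.inr l')) (by simpa using h)
  simpa using this

omit [DecidableEq τ] in
/-- `w` is injective (freshness of Claim 38's `w`, `z`). [cite: ChatterjeeTengse2023, Claim 38 (v1: p0013.txt:L9–L13)] -/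
theorem w_inj : Function.Injective w := fun l l' h => by
  have := @F.inj (Sum.inr (Sum.inl l)) (Sum.inr (Sum.inl l')) (by simpa using h)
  simpa using this

omit [DecidableEq τ] in
/-- `a` misses `b` (freshness of Claim 38's `w`, `z`). [cite: ChatterjeeTengse2023, Claim 38 (v1: p0013.txt:L9–L13)] -/
theorem a_ne_b (l l' : Fin L) : a l ≠ b l' := fun h => by
  have := @F.inj (Sum.inl (Sum.inl l)) (Sum.inl (Sum.inr l')) (by simpa using h)
  simp at this

omit [DecidableEq τ] in
/-- `a` misses `w` (freshness of Claim 38's `w`, `z`). [cite: ChatterjeeTengse2023, Claim 38 (v1: p0013.txt:L9–L13)] -/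
theorem a_ne_w (l l' : Fin L) : a l ≠ w l' := fun h => by
  have := @F.inj (Sum.inl (Sum.inl l)) (Sum.inr (Sum.inl l')) (by simpa using h)
  simp at this

omit [DecidableEq τ] in
/-- `b` misses `w` (freshness of Claim 38's `w`, `z`). [cite: ChatterjeeTengse2023, Claim 38 (v1: p0013.txt:L9–L13)] -/
theorem b_ne_w (l l' : Fin L) : b l ≠ w l' := fun h => by
  have := @F.inj (Sum.inl (Sum.inr l)) (Sum.inr (Sum.inl l')) (by simpa using h)
  simp at this

omit [DecidableEq τ] in
/-- `a` misses `z` (freshness of Claim 38's `w`, `z`). [cite: ChatterjeeTengse2023, Claim 38 (v1: p0013.txt:L9–L13)] -/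
theorem a_ne_z (l : Fin L) : a l ≠ z := fun h => by
  have := @F.inj (Sum.inl (Sum.inl l)) (Sum.inr (Sum.inr ())) (by simpa using h)
  simp at this

omit [DecidableEq τ] in
/-- `b` misses `z` (freshness of Claim 38's `w`, `z`). [cite: ChatterjeeTengse2023, Claim 38 (v1: p0013.txt:L9–L13)] -/
theorem b_ne_z (l : Fin L) : b l ≠ z := fun h => by
  have := @F.inj (Sum.inl (Sum.inr l)) (Sum.inr (Sum.inr ())) (by simpa using h)
  simp at this

omit [DecidableEq τ] in
/-- `w` misses `z` (freshness of Claim 38's `w`, `z`). [cite: ChatterjeeTengse2023, Claim 38 (v1: p0013.txt:L9–L13)] -/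
theorem w_ne_z (l : Fin L) : w l ≠ z := fun h => by
  have := @F.inj (Sum.inr (Sum.inl l)) (Sum.inr (Sum.inr ())) (by simpa using h)
  simp at this

end Fresh

variable (a b w : Fin L → τ) (z : τ)

/-- The multiplexer `(1 − z)·a_l + z·w_l`, written as the circuit computes it: `a_l + (w_l − a_l)·z`.
[cite: ChatterjeeTengse2023, Claim 38 "`(1−z)u + zw`" (v1: p0013.txt:L11)] -/
def muxA (l : Fin L) : MvPolynomial τ k := X (a l) + (X (w l) + (-1 : k) • X (a l)) * X z

/-- The multiplexer `(1 − z)·w_l + z·b_l = w_l + (b_l − w_l)·z`.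
[cite: ChatterjeeTengse2023, Claim 38 "`(1−z)w + zv`" (v1: p0013.txt:L11)] -/
def muxB (l : Fin L) : MvPolynomial τ k := X (w l) + (X (b l) + (-1 : k) • X (w l)) * X z

/-- The substitution `u ↦ (1−z)u + zw`, `v ↦ (1−z)w + zv` of Claim 38 (identity off the blocks).
[cite: ChatterjeeTengse2023, Claim 38 (v1: p0013.txt:L11)] -/
def muxSubst : τ → MvPolynomial τ k :=
  onBlock a (muxA a w z) (onBlock b (muxB b w z) X)

/-- **Claim 38's `D₁`**: `Σ_{w} ( proj_{z=0} P₁ · proj_{z=1} P₁ )` with `P₁ = E ∘ muxSubst`.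
[cite: ChatterjeeTengse2023, Claim 38 (v1: p0013.txt:L11–L14)] -/
def sqPoly (E : MvPolynomial τ k) : MvPolynomial τ k :=
  blkBoolSum w L (production z (aeval (muxSubst a b w z) E))

variable {a b w z}

/-- `proj_{z=0} P₁ = E(a, w)`: at `z = 0` the multiplexers select `(a, w)`.
[cite: ChatterjeeTengse2023, Claim 38 (v1: p0013.txt:L11–L14)] -/
theorem projVar_zero_aeval_muxSubst (F : Fresh a b w z) {E : MvPolynomial τ k}
    (hz : z ∉ E.vars) :
    projVar z (0 : k) (aeval (muxSubst a b w z) E) =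
      aeval (onBlock (β := MvPolynomial τ k) a (fun l => X (a l)) (onBlock b (fun l => X (w l)) X)) E := by
  rw [projVar_aeval]
  refine aeval_congr_vars fun v hv => ?_
  by_cases ha : ∃ l, a l = v
  · obtain ⟨l, rfl⟩ := ha
    rw [muxSubst, onBlock_blk F.a_inj, onBlock_blk F.a_inj, muxA]
    simp [projVar, F.a_ne_z, F.w_ne_z]
  · have ha' : ∀ l, a l ≠ v := fun l hl => ha ⟨l, hl⟩
    by_cases hb : ∃ l, b l = v
    · obtain ⟨l, rfl⟩ := hb
      rw [muxSubst, onBlock_of_ne ha', onBlock_of_ne ha', onBlock_blk F.b_inj, onBlock_blk F.b_inj,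
        muxB]
      simp [projVar, F.b_ne_z, F.w_ne_z]
    · have hb' : ∀ l, b l ≠ v := fun l hl => hb ⟨l, hl⟩
      have hvz : v ≠ z := fun h => hz (h ▸ hv)
      rw [muxSubst, onBlock_of_ne ha', onBlock_of_ne ha', onBlock_of_ne hb', onBlock_of_ne hb',
        projVar_X_of_ne hvz]

/-- `proj_{z=1} P₁ = E(w, b)`: at `z = 1` the multiplexers select `(w, b)`.
[cite: ChatterjeeTengse2023, Claim 38 (v1: p0013.txt:L11–L14)] -/
theorem projVar_one_aeval_muxSubst (F : Fresh a b w z) {E : MvPolynomial τ k}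
    (hz : z ∉ E.vars) :
    projVar z (1 : k) (aeval (muxSubst a b w z) E) =
      aeval (onBlock (β := MvPolynomial τ k) a (fun l => X (w l)) (onBlock b (fun l => X (b l)) X)) E := by
  rw [projVar_aeval]
  refine aeval_congr_vars fun v hv => ?_
  by_cases ha : ∃ l, a l = v
  · obtain ⟨l, rfl⟩ := ha
    rw [muxSubst, onBlock_blk F.a_inj, onBlock_blk F.a_inj, muxA]
    simp [projVar, F.a_ne_z, F.w_ne_z]
  · have ha' : ∀ l, a l ≠ v := fun l hl => ha ⟨l, hl⟩
    by_cases hb : ∃ l, b l = v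
    · obtain ⟨l, rfl⟩ := hb
      rw [muxSubst, onBlock_of_ne ha', onBlock_of_ne ha', onBlock_blk F.b_inj, onBlock_blk F.b_inj,
        muxB]
      simp [projVar, F.b_ne_z, F.w_ne_z]
    · have hb' : ∀ l, b l ≠ v := fun l hl => hb ⟨l, hl⟩
      have hvz : v ≠ z := fun h => hz (h ▸ hv)
      rw [muxSubst, onBlock_of_ne ha', onBlock_of_ne ha', onBlock_of_ne hb', onBlock_of_ne hb',
        projVar_X_of_ne hvz]

/-- Bits on `a`, `b` after bits on `w` after `(a, w)`-selection = the entry `(α, κ)`.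
[cite: ChatterjeeTengse2023, Claim 38 "`D₁` encodes `A²`" (v1: p0013.txt:L14)] -/
theorem entry_left (F : Fresh a b w z) {E : MvPolynomial τ k} (hw : ∀ l, w l ∉ E.vars)
    (α β κ : Fin L → Bool) :
    aeval (onBlock (β := MvPolynomial τ k) a (fun l => bit (α l)) (onBlock b (fun l => bit (β l)) X))
      (aeval (onBlock (β := MvPolynomial τ k) w (fun l => bit (κ l)) X)
        (aeval (onBlock (β := MvPolynomial τ k) a (fun l => X (a l)) (onBlock b (fun l => X (w l)) X)) E)) =
      matOf a b E α κ := by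
  rw [← AlgHom.comp_apply, comp_aeval, ← AlgHom.comp_apply, comp_aeval, matOf, Matrix.of_apply]
  refine aeval_congr_vars fun v hv => ?_
  have hvw : ∀ l, w l ≠ v := fun l hl => hw l (hl ▸ hv)
  by_cases ha : ∃ l, a l = v
  · obtain ⟨l, rfl⟩ := ha
    simp only [onBlock_blk F.a_inj, aeval_X, onBlock_of_ne (fun l' => (F.a_ne_w l l').symm)]
  · have ha' : ∀ l, a l ≠ v := fun l hl => ha ⟨l, hl⟩
    by_cases hb : ∃ l, b l = v
    · obtain ⟨l, rfl⟩ := hb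
      simp only [onBlock_of_ne ha', onBlock_blk F.b_inj, aeval_X, onBlock_blk F.w_inj, aeval_bit]
    · have hb' : ∀ l, b l ≠ v := fun l hl => hb ⟨l, hl⟩
      simp only [onBlock_of_ne ha', onBlock_of_ne hb', aeval_X, onBlock_of_ne hvw]

/-- Bits on `a`, `b` after bits on `w` after `(w, b)`-selection = the entry `(κ, β)`.
[cite: ChatterjeeTengse2023, Claim 38 "`D₁` encodes `A²`" (v1: p0013.txt:L14)] -/
theorem entry_right (F : Fresh a b w z) {E : MvPolynomial τ k} (hw : ∀ l, w l ∉ E.vars)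
    (α β κ : Fin L → Bool) :
    aeval (onBlock (β := MvPolynomial τ k) a (fun l => bit (α l)) (onBlock b (fun l => bit (β l)) X))
      (aeval (onBlock (β := MvPolynomial τ k) w (fun l => bit (κ l)) X)
        (aeval (onBlock (β := MvPolynomial τ k) a (fun l => X (w l)) (onBlock b (fun l => X (b l)) X)) E)) =
      matOf a b E κ β := by
  rw [← AlgHom.comp_apply, comp_aeval, ← AlgHom.comp_apply, comp_aeval, matOf, Matrix.of_apply]
  refine aeval_congr_vars fun v hv => ?_
  have hvw : ∀ l, w l ≠ v := fun l hl => hw l (hl ▸ hv)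
  by_cases ha : ∃ l, a l = v
  · obtain ⟨l, rfl⟩ := ha
    simp only [onBlock_blk F.a_inj, aeval_X, onBlock_blk F.w_inj, aeval_bit]
  · have ha' : ∀ l, a l ≠ v := fun l hl => ha ⟨l, hl⟩
    by_cases hb : ∃ l, b l = v
    · obtain ⟨l, rfl⟩ := hb
      simp only [onBlock_of_ne ha', onBlock_blk F.b_inj, aeval_X,
        onBlock_of_ne (fun l' => (F.b_ne_w l l').symm)]
    · have hb' : ∀ l, b l ≠ v := fun l hl => hb ⟨l, hl⟩
      simp only [onBlock_of_ne ha', onBlock_of_ne hb', aeval_X, onBlock_of_ne hvw]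

/-- **Claim 38: `D₁` encodes `A²`.** For an encoder `E` not mentioning the fresh block `w` and the
fresh selector `z`, the matrix of `sqPoly a b w z E` on the index blocks `a, b` is the square of
the matrix of `E`. [cite: ChatterjeeTengse2023, Claim 38 "Note that `D₁` encodes the adjacency matrix `A²` when `C_A` encodes `A`" (v1: p0013.txt:L14)] -/
theorem matOf_sqPoly (F : Fresh a b w z) {E : MvPolynomial τ k} (hw : ∀ l, w l ∉ E.vars)
    (hz : z ∉ E.vars) :
    matOf a b (sqPoly a b w z E) = matOf a b E * matOf a b E := by
  refine Matrix.ext fun α β => ?_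
  rw [Matrix.mul_apply]
  change aeval (onBlock (β := MvPolynomial τ k) a (fun l => bit (α l)) (onBlock b (fun l => bit (β l)) X))
    (sqPoly a b w z E) = _
  rw [sqPoly, blkBoolSum_eq_sum, map_sum]
  refine Finset.sum_congr rfl fun κ _ => ?_
  rw [production, projVar_zero_aeval_muxSubst F hz, projVar_one_aeval_muxSubst F hz, map_mul,
    map_mul]
  exact congrArg₂ (· * ·) (entry_left F hw α β κ) (entry_right F hw α β κ)

end Squaring

/-! ### The circuit: ONE copy of the encoder (brick E-a's `ProjCircuit.subst`), a production gate,
and one summation gate per bit of `w` -/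

section Circuit

variable (a b w : Fin L → τ) (z : τ)

/-- The constant-free circuit of the multiplexer `a_l + (w_l − a_l)·z` (4 gates).
[cite: ChatterjeeTengse2023, Claim 38 (v1: p0013.txt:L11)] -/
def muxACircuit (l : Fin L) : ArithCircuit k τ :=
  (ArithCircuit.ofVar (a l)).add
    (((ArithCircuit.ofVar (w l)).add ((ArithCircuit.ofVar (a l)).smul (-1))).mul
      (ArithCircuit.ofVar z))

/-- The constant-free circuit of the multiplexer `w_l + (b_l − w_l)·z` (4 gates).
[cite: ChatterjeeTengse2023, Claim 38 (v1: p0013.txt:L11)] -/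
def muxBCircuit (l : Fin L) : ArithCircuit k τ :=
  (ArithCircuit.ofVar (w l)).add
    (((ArithCircuit.ofVar (b l)).add ((ArithCircuit.ofVar (w l)).smul (-1))).mul
      (ArithCircuit.ofVar z))

/-- The `2L` multiplexer circuits, juxtaposed as the PREFIX of the substitution.
[cite: ChatterjeeTengse2023, Claim 38 (v1: p0013.txt:L11)] -/
def muxList : List (ArithCircuit k τ) :=
  (List.finRange L).map (muxACircuit (k := k) a w z) ++
    (List.finRange L).map (muxBCircuit (k := k) b w z)

/-- The operands replacing the free inputs: `a_l ↦` output of the `l`-th multiplexer,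
`b_l ↦` output of the `(L + l)`-th, every other variable unchanged.
[cite: ChatterjeeTengse2023, Claim 38 (v1: p0013.txt:L11)] -/
def muxOperands : τ → ArithCircuit.Operand k τ :=
  onBlock a (fun l => (ArithCircuit.juxtOuts (muxList (k := k) a b w z)).getD l (.var (a l)))
    (onBlock b (fun l => (ArithCircuit.juxtOuts (muxList (k := k) a b w z)).getD (L + l)
      (.var (b l))) .var)

/-- **The squaring circuit `D₁`**: the encoder's circuit with its free inputs `a, b` replaced by the
multiplexers (ONE copy, `ProjCircuit.subst`), then the production gate over `z`, then `L`
summation gates over `w`. [cite: ChatterjeeTengse2023, Claim 38 (v1: p0013.txt:L11–L25)] -/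
def sqCircuit (C : ProjCircuit k τ) : ProjCircuit k τ :=
  ((C.subst ((ArithCircuit.juxtGates (muxList (k := k) a b w z)).map ProjCircuit.Gate.arith) id
      (muxOperands (k := k) a b w z)).productionCircuit z).blkSumCircuit w L

variable {a b w z}

omit [DecidableEq τ] in
/-- Semantics of the multiplexer circuits. [cite: ChatterjeeTengse2023, Claim 38 (v1: p0013.txt:L11)] -/
theorem eval_muxACircuit (l : Fin L) : (muxACircuit (k := k) a w z l).eval = muxA a w z l := by
  simp [muxACircuit, muxA, ArithCircuit.add_eval, ArithCircuit.mul_eval, ArithCircuit.eval_smul,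
    ArithCircuit.eval_ofVar]

omit [DecidableEq τ] in
/-- Semantics of the multiplexer circuits. [cite: ChatterjeeTengse2023, Claim 38 (v1: p0013.txt:L11)] -/
theorem eval_muxBCircuit (l : Fin L) : (muxBCircuit (k := k) b w z l).eval = muxB b w z l := by
  simp [muxBCircuit, muxB, ArithCircuit.add_eval, ArithCircuit.mul_eval, ArithCircuit.eval_smul,
    ArithCircuit.eval_ofVar]

omit [DecidableEq τ] in
/-- Four gates each. [cite: ChatterjeeTengse2023, Claim 38 (v1: p0013.txt:L22–L25)] -/
theorem size_muxACircuit (l : Fin L) : (muxACircuit (k := k) a w z l).size = 4 := by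
  simp [muxACircuit, ArithCircuit.size_add, ArithCircuit.size_mul, ArithCircuit.size_smul,
    ArithCircuit.size_ofVar]

omit [DecidableEq τ] in
/-- Four gates each. [cite: ChatterjeeTengse2023, Claim 38 (v1: p0013.txt:L22–L25)] -/
theorem size_muxBCircuit (l : Fin L) : (muxBCircuit (k := k) b w z l).size = 4 := by
  simp [muxBCircuit, ArithCircuit.size_add, ArithCircuit.size_mul, ArithCircuit.size_smul,
    ArithCircuit.size_ofVar]

omit [DecidableEq τ] in
/-- The multiplexer circuits have fan-in two and sign constants.
[cite: ChatterjeeTengse2023, Claim 38 "constant-free" (v1: p0013.txt:L25)] -/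
theorem muxList_spec : ∀ Q ∈ muxList (k := k) a b w z, Q.IsFanInTwo ∧ Q.HasSignConstants ∧ Q.size = 4 := by
  intro Q hQ
  simp only [muxList, List.mem_append, List.mem_map, List.mem_finRange, true_and] at hQ
  rcases hQ with ⟨l, rfl⟩ | ⟨l, rfl⟩
  · refine ⟨?_, ?_, size_muxACircuit l⟩
    · exact (ArithCircuit.IsFanInTwo.ofVar _).add
        ((((ArithCircuit.IsFanInTwo.ofVar _).add ((ArithCircuit.IsFanInTwo.ofVar _).smul)).mul
          (ArithCircuit.IsFanInTwo.ofVar _)))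
    · exact (ArithCircuit.HasSignConstants.ofVar _).add
        ((((ArithCircuit.HasSignConstants.ofVar _).add
          (ArithCircuit.HasSignConstants.smul ArithCircuit.isSignConstant_neg_one
            (ArithCircuit.HasSignConstants.ofVar _))).mul
          (ArithCircuit.HasSignConstants.ofVar _)))
  · refine ⟨?_, ?_, size_muxBCircuit l⟩
    · exact (ArithCircuit.IsFanInTwo.ofVar _).add
        ((((ArithCircuit.IsFanInTwo.ofVar _).add ((ArithCircuit.IsFanInTwo.ofVar _).smul)).mul
          (ArithCircuit.IsFanInTwo.ofVar _)))
    · exact (ArithCircuit.HasSignConstants.ofVar _).add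
        ((((ArithCircuit.HasSignConstants.ofVar _).add
          (ArithCircuit.HasSignConstants.smul ArithCircuit.isSignConstant_neg_one
            (ArithCircuit.HasSignConstants.ofVar _))).mul
          (ArithCircuit.HasSignConstants.ofVar _)))

omit [DecidableEq τ] in
/-- The prefix has `8L` gates. [cite: ChatterjeeTengse2023, Claim 38 (v1: p0013.txt:L22–L25)] -/
theorem length_juxtGates_muxList :
    (ArithCircuit.juxtGates (muxList (k := k) a b w z)).length = 8 * L := by
  rw [ArithCircuit.length_juxtGates]
  have : (muxList (k := k) a b w z).map ArithCircuit.size = List.replicate (L + L) 4 := by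
    apply List.ext_getElem
    · simp [muxList]
    · intro i h1 h2
      rw [List.getElem_replicate, List.getElem_map]
      exact (muxList_spec _ (List.getElem_mem _)).2.2
  rw [this, List.sum_replicate]
  ring

omit [DecidableEq τ] in
/-- The `l`-th circuit of the prefix list is the `l`-th `a`-multiplexer. [folklore] -/
private theorem muxList_getElem_left (l : Fin L) (h : (l : ℕ) < (muxList (k := k) a b w z).length) :
    (muxList (k := k) a b w z)[(l : ℕ)] = muxACircuit a w z l := by
  simp [muxList, List.getElem_append_left]

omit [DecidableEq τ] in
/-- The `(L + l)`-th circuit of the prefix list is the `l`-th `b`-multiplexer. [folklore] -/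
private theorem muxList_getElem_right (l : Fin L)
    (h : L + (l : ℕ) < (muxList (k := k) a b w z).length) :
    (muxList (k := k) a b w z)[L + (l : ℕ)] = muxBCircuit b w z l := by
  simp [muxList, List.getElem_append_right]

/-- The operands read the multiplexers off the prefix values.
[cite: ChatterjeeTengse2023, Claim 38 (v1: p0013.txt:L11)] -/
theorem eval_muxOperands (F : Fresh a b w z) (v : τ) (ws : List (MvPolynomial τ k)) :
    (muxOperands (k := k) a b w z v).eval
        (ProjCircuit.gateValues ((ArithCircuit.juxtGates (muxList (k := k) a b w z)).map
          ProjCircuit.Gate.arith) ++ ws) =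
      muxSubst a b w z v := by
  rw [ProjCircuit.gateValues_map_arith]
  have hlen : (muxList (k := k) a b w z).length = L + L := by simp [muxList]
  by_cases ha : ∃ l, a l = v
  · obtain ⟨l, rfl⟩ := ha
    have hl : (l : ℕ) < (muxList (k := k) a b w z).length := by omega
    rw [muxOperands, muxSubst, onBlock_blk F.a_inj, onBlock_blk F.a_inj,
      List.getD_eq_getElem _ _ (by simpa using hl), ArithCircuit.eval_juxtOuts _ _ hl,
      muxList_getElem_left, eval_muxACircuit]
  · have ha' : ∀ l, a l ≠ v := fun l hl => ha ⟨l, hl⟩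
    by_cases hb : ∃ l, b l = v
    · obtain ⟨l, rfl⟩ := hb
      have hl : L + (l : ℕ) < (muxList (k := k) a b w z).length := by omega
      rw [muxOperands, muxSubst, onBlock_of_ne ha', onBlock_of_ne ha', onBlock_blk F.b_inj,
        onBlock_blk F.b_inj, List.getD_eq_getElem _ _ (by simpa using hl),
        ArithCircuit.eval_juxtOuts _ _ hl, muxList_getElem_right, eval_muxBCircuit]
    · have hb' : ∀ l, b l ≠ v := fun l hl => hb ⟨l, hl⟩
      rw [muxOperands, muxSubst, onBlock_of_ne ha', onBlock_of_ne ha', onBlock_of_ne hb',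
        onBlock_of_ne hb']
      rfl

/-- A variable that is none of `a, b, w, z` is fixed by the multiplexing substitution, and the
multiplexers are fixed by projecting it ((C1)/(C2) of brick E-a for such variables).
[cite: ChatterjeeTengse2023, Claim 38 (v1: p0013.txt:L9–L25)] -/
theorem substCompat_muxSubst (F : Fresh a b w z) {C : ProjCircuit k τ}
    (hC : ∀ i ∈ C.projVars, (∀ l, a l ≠ i) ∧ (∀ l, b l ≠ i) ∧ (∀ l, w l ≠ i) ∧ i ≠ z) :
    C.SubstCompat id (muxSubst (k := k) a b w z) := by
  intro i hi c v
  obtain ⟨hia, hib, hiw, hiz⟩ := hC i hi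
  refine aeval_projVar_comm c ?_ (fun i' hi' => ?_) v
  · rw [muxSubst, onBlock_of_ne hia, onBlock_of_ne hib]; rfl
  · change projVar i c (muxSubst a b w z i') = _
    by_cases ha : ∃ l, a l = i'
    · obtain ⟨l, rfl⟩ := ha
      rw [muxSubst, onBlock_blk F.a_inj, muxA]
      simp [projVar, (hia l), (hiw l), hiz.symm]
    · have ha' : ∀ l, a l ≠ i' := fun l hl => ha ⟨l, hl⟩
      by_cases hb : ∃ l, b l = i'
      · obtain ⟨l, rfl⟩ := hb
        rw [muxSubst, onBlock_of_ne ha', onBlock_blk F.b_inj, muxB]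
        simp [projVar, (hib l), (hiw l), hiz.symm]
      · have hb' : ∀ l, b l ≠ i' := fun l hl => hb ⟨l, hl⟩
        rw [muxSubst, onBlock_of_ne ha', onBlock_of_ne hb']
        exact projVar_X_of_ne hi' c

/-- **`sqCircuit` computes `D₁ = sqPoly`.** [cite: ChatterjeeTengse2023, Claim 38 (v1: p0013.txt:L11–L25)] -/
theorem eval_sqCircuit (F : Fresh a b w z) {C : ProjCircuit k τ} {E : MvPolynomial τ k}
    (hCE : C.Computes E)
    (hC : ∀ i ∈ C.projVars, (∀ l, a l ≠ i) ∧ (∀ l, b l ≠ i) ∧ (∀ l, w l ≠ i) ∧ i ≠ z) :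
    (sqCircuit (k := k) a b w z C).eval = sqPoly a b w z E := by
  rw [sqCircuit, ProjCircuit.eval_blkSumCircuit _ F.w_inj le_rfl, ProjCircuit.eval_productionCircuit,
    ProjCircuit.eval_subst _ _ (eval_muxOperands F) (substCompat_muxSubst F hC), sqPoly,
    show C.eval = E from hCE]

omit [DecidableEq τ] in
/-- **Size: ONE copy of the encoder plus `O(L)`** — exactly `|C| + 11·L + 3` gates (`8L` for the
multiplexers, `3` for the production gate, `3L` for the summations).
[cite: ChatterjeeTengse2023, Claim 38 "exactly one use … all these increases are additive" (v1: p0013.txt:L22–L25)] -/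
theorem size_sqCircuit [DecidableEq τ] (C : ProjCircuit k τ) :
    (sqCircuit (k := k) a b w z C).size = C.size + 11 * L + 3 := by
  rw [sqCircuit, ProjCircuit.size_blkSumCircuit _ _ le_rfl, ProjCircuit.size_productionCircuit,
    ProjCircuit.size_subst, List.length_map, length_juxtGates_muxList]
  ring

/-- Fan-in two is kept. [cite: ChatterjeeTengse2023, Claim 38 (v1: p0013.txt:L22–L25)] -/
theorem isFanInTwo_sqCircuit {C : ProjCircuit k τ} (hC : C.IsFanInTwo) :
    (sqCircuit (k := k) a b w z C).IsFanInTwo :=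
  ProjCircuit.isFanInTwo_blkSumCircuit
    (ProjCircuit.isFanInTwo_productionCircuit
      (ProjCircuit.isFanInTwo_subst hC (fun g hg => by
          obtain ⟨g', hg', rfl⟩ := List.mem_map.1 hg
          exact ArithCircuit.fanIn_juxtGates (fun Q hQ => (muxList_spec Q hQ).1) g' hg') _ _) _) _ _

/-- Constant-freeness is kept ("`C'` is constant-free if `C` is constant free").
[cite: ChatterjeeTengse2023, Claim 38 (v1: p0013.txt:L25)] -/
theorem hasSignConstants_sqCircuit {C : ProjCircuit k τ} (hC : C.HasSignConstants) :
    (sqCircuit (k := k) a b w z C).HasSignConstants := by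
  refine ProjCircuit.hasSignConstants_blkSumCircuit
    (ProjCircuit.hasSignConstants_productionCircuit
      (ProjCircuit.hasSignConstants_subst hC (fun g hg => by
          obtain ⟨g', hg', rfl⟩ := List.mem_map.1 hg
          exact ArithCircuit.hasSignConstants_juxtGates (fun Q hQ => (muxList_spec Q hQ).2.1) g' hg')
        _ (fun i => ?_)) _) _ _
  unfold muxOperands onBlock
  split_ifs <;> try dsimp only
  · rw [List.getD_eq_getElem?_getD]
    cases h : (ArithCircuit.juxtOuts (muxList (k := k) a b w z))[(↑(Fin.find _ ‹_›) : ℕ)]? with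
    | none => exact ArithCircuit.Operand.hasSignConstants_var _
    | some u =>
      exact ArithCircuit.hasSignConstants_juxtOuts (fun Q hQ => (muxList_spec Q hQ).2.1) u
        (List.mem_of_getElem? h)
  · rw [List.getD_eq_getElem?_getD]
    cases h : (ArithCircuit.juxtOuts (muxList (k := k) a b w z))[L + (↑(Fin.find _ ‹_›) : ℕ)]? with
    | none => exact ArithCircuit.Operand.hasSignConstants_var _
    | some u =>
      exact ArithCircuit.hasSignConstants_juxtOuts (fun Q hQ => (muxList_spec Q hQ).2.1) u
        (List.mem_of_getElem? h)
  · exact ArithCircuit.Operand.hasSignConstants_var _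

/-- The squaring circuit projects, on top of what `C` projects, only `z` and the block `w`
(so the NEXT level may substitute `a, b` again with fresh `w', z'`).
[cite: ChatterjeeTengse2023, Claim 38 "we define `P_{i+1}` by using `D_i` in place of `C_A`" (v1: p0013.txt:L18–L21)] -/
theorem projVars_sqCircuit_subset (C : ProjCircuit k τ) :
    (sqCircuit (k := k) a b w z C).projVars ⊆ C.projVars ∪ ({z} ∪ Set.range w) := by
  intro v hv
  have h1 := ProjCircuit.projVars_blkSumCircuit_subset _ _ _ hv
  rcases h1 with h1 | h1
  · -- inside the production circuit over the substituted circuit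
    obtain ⟨c, u, hg⟩ := h1
    simp only [ProjCircuit.productionCircuit, List.mem_append, List.mem_cons, List.mem_nil_iff,
      or_false, ProjCircuit.Gate.proj.injEq] at hg
    rcases hg with hg | ⟨rfl, -, -⟩ | ⟨rfl, -, -⟩ | hg
    · -- a gate of the substituted circuit: prefix gates are arithmetic, the others relabelled by `id`
      simp only [ProjCircuit.subst, List.mem_append, List.mem_map] at hg
      rcases hg with hg | ⟨g', hg', hg'e⟩
      · -- prefix gates are arithmetic (`Gate.arith`), never projections
        obtain ⟨g', -, h⟩ := hg
        cases h
      · cases g' with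
        | arith g => simp [ProjCircuit.Gate.subst] at hg'e
        | proj i b' u' =>
          simp only [ProjCircuit.Gate.subst, ProjCircuit.Gate.proj.injEq] at hg'e
          obtain ⟨rfl, -, -⟩ := hg'e
          exact Or.inl ⟨b', u', hg'⟩
    · exact Or.inr (Or.inl rfl)
    · exact Or.inr (Or.inl rfl)
    · cases hg
  · exact Or.inr (Or.inr h1)

end Circuit

end Literature.Barriers.ValiantsHypothesis
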